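import Mathlib
import Literature.Analysis.FluidPDE.PressureReconstruction
import Literature.Analysis.FluidPDE.SverakLandauPoincare
import HarnessLib

/-!
# de Rham for smooth fields on the exterior of a ball: fields orthogonal to solenoidal tests are gradients

Analysis/FluidPDE support file (tool T2 of the free-space sink completion, route PointSink of the
anomalous-dissipation summit: the PRESSURE of the smooth linear subsolutions `ρ ⋆ (V ⊗ V)` of
`MollifiedEulerCone`, which are only known to pair to zero with solenoidal tests supported OFF a
ball). Two classical statements, localized to open sets / exterior domains:

* `inner_fderiv_comm_of_forall_integral_inner_eq_zero_on` — **local de Rham, symmetric form**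
  (any finite-dimensional inner product space `E`, any open `U ⊆ E`): a smooth field `g` with
  `∫ ⟪g, φ⟫ = 0` for all smooth divergence-free `φ ∈ C_c^∞(U)` has a symmetric derivative on `U`,
  `⟪Dg(x)v, w⟫ = ⟪Dg(x)w, v⟫` (`curl g = 0` on `U`). Proof as for the tree's whole-space version
  `FluidPDE.inner_fderiv_comm_of_forall_integral_inner_eq_zero` (`PressureReconstruction`): test
  with `φ = (∂ᵥψ) w − (∂_wψ) v`, `ψ ∈ C_c^∞(U)`, integrate by parts, and apply the fundamental lemma
  of the calculus of variations ON `U` (Mathlib `IsOpen.ae_eq_zero_of_integral_contDiff_smul_eq_zero`)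
  plus `eq_zero_of_ae_zero_on` (a continuous function vanishing a.e. on an open set vanishes there).
* `exists_primitive_exterior` — **Poincaré lemma on the exterior of a ball in `ℝ³`**: a `1`-form
  differentiable with symmetric derivative on `{a < ‖x‖}` has a primitive on `{4a < ‖x‖}`: the four
  convex half-spaces `{2a < ⟪wᵢ, x⟫}`, `wᵢ ∈ {(1,1,1), (1,−1,−1), (−1,1,−1), (−1,−1,1)}`, lie in
  `{a < ‖x‖}` (`halfSpace_subset_exterior`, Cauchy–Schwarz) and cover `{4a < ‖x‖}`
  (`cover_halfSpaces_exterior`); Mathlib's convex Poincaré lemma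
  (`Convex.exists_forall_hasFDerivAt_of_fderiv_symmetric`) on each, glued three times along
  preconnected overlaps (`Sverak2011.exists_primitive_union`; this is the `a = 0` argument of
  `Sverak2011.exists_primitive_compl_zero` pushed off a ball). No sign condition on `a`.
* `exists_potential_of_forall_integral_inner_eq_zero` — **the two combined**: a smooth `g : ℝ³ → ℝ³`
  orthogonal to solenoidal tests supported in `{a < ‖x‖}` is a smooth gradient on `{4a < ‖x‖}`,
  `∇q = g` (`HasGradientAt`, `ContDiffOn ℝ ∞ q`). The loss `a ↦ 4a` (from the finite cover) is
  harmless for the intended use on shells accumulating at a sphere of radius `≫ a`; the sharp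
  domain `{a < ‖x‖}` would need a path-integral primitive.

## Mathlib / tree search

Mathlib (this pin): convex Poincaré lemma `Convex.exists_forall_hasFDerivAt_of_fderiv_symmetric`,
local fundamental lemma `IsOpen.ae_eq_zero_of_integral_contDiff_smul_eq_zero`,
`IsOpen.measure_pos`; no de Rham theorem for non-convex domains. Tree: `PressureReconstruction`
(whole-space de Rham + segment potential; its helper lemmas `isDivFree_fderiv_smul_sub`,
`isTestFunctionOn_fderiv_smul_sub`, `integral_fderiv_apply_mul_eq_neg` are reused),
`SverakLandauPoincare` (`ℝ³ ∖ {0}`; gluing lemma reused), `HomogeneousEulerProofs.exists_primitive_of_cover`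
(convex covers with a hub), `TorusPressureReconstruction` (torus). Nothing for exterior domains or
shells (searched `exterior\|annulus\|shell` with `primitive\|potential\|deRham`, 2026-08-17).
No definitions, no named facts.

## References

* G. P. Galdi, *An Introduction to the Mathematical Theory of the Navier–Stokes Equations*,
  2nd ed. (2011), Lemma III.1.1 (fields orthogonal to solenoidal test fields are gradients).
* R. Temam, *Navier–Stokes Equations*, North-Holland (1977), Ch. I, Prop. 1.1.
* V. Šverák, *On Landau's solutions of the Navier–Stokes equations*, J. Math. Sci. 179 (2011),
  §4 (the four-half-space rendering of "`dv = 0 ⇒ v = ∇φ`" used by the tree).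
-/

noncomputable section

open MeasureTheory TopologicalSpace Set Function Filter Metric
open scoped ContDiff RealInnerProductSpace Topology

namespace Literature.Analysis.FluidPDE

namespace ExteriorDeRham

/-! ### Local de Rham: orthogonality to solenoidal tests in `U` gives a symmetric derivative on `U` -/

section Local

variable {E : Type*} [NormedAddCommGroup E] [InnerProductSpace ℝ E] [FiniteDimensional ℝ E]
  [MeasurableSpace E] [BorelSpace E]

omit [FiniteDimensional ℝ E] [MeasurableSpace E] [BorelSpace E] in
/-- The test field `φ = (∂ᵥψ) w − (∂_w ψ) v` built from a test function `ψ` on `U` is a test field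
on `U` (its support lies in `tsupport ψ`). [folklore] -/
theorem isTestFunctionOn_fderiv_smul_sub {U : Opens E} {ψ : E → ℝ}
    (hψ : FunctionSpaces.IsTestFunctionOn U ψ) (v w : E) :
    FunctionSpaces.IsTestFunctionOn U (fun y => (fderiv ℝ ψ y v) • w - (fderiv ℝ ψ y w) • v) := by
  have h := FluidPDE.isTestFunctionOn_fderiv_smul_sub hψ.contDiff hψ.hasCompactSupport v w
  refine ⟨h.contDiff, h.hasCompactSupport, ?_⟩
  refine (closure_minimal (fun y hy => ?_) (isClosed_tsupport ψ)).trans hψ.tsupport_subset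
  by_contra hy'
  apply hy
  simp [fderiv_of_notMem_tsupport ℝ hy']

/-- A continuous real function vanishing a.e. on an open set vanishes on it (Haar measure charges
nonempty open sets). [folklore] -/
theorem eq_zero_of_ae_zero_on {U : Set E} (hU : IsOpen U) {m : E → ℝ} (hm : Continuous m)
    (hae : ∀ᵐ x ∂(volume : Measure E), x ∈ U → m x = 0) {x : E} (hx : x ∈ U) : m x = 0 := by
  by_contra h
  have hO : IsOpen (U ∩ {y | m y ≠ 0}) := hU.inter (isOpen_ne_fun hm continuous_const)
  have hpos : 0 < volume (U ∩ {y | m y ≠ 0}) := hO.measure_pos volume ⟨x, hx, h⟩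
  have hzero : volume (U ∩ {y | m y ≠ 0}) = 0 := by
    rw [ae_iff] at hae
    refine measure_mono_null (fun y hy => ?_) hae
    simpa [Classical.not_imp] using hy
  exact hpos.ne' hzero

/-- **Local de Rham for smooth fields (symmetric-derivative form).** If a smooth vector field `g`
on `E` satisfies `∫ ⟪g, φ⟫ = 0` for every smooth divergence-free field `φ` compactly supported in
the open set `U`, then `Dg` is symmetric on `U`: `⟪Dg(x) v, w⟫ = ⟪Dg(x) w, v⟫` for `x ∈ U`
(test against `φ = (∂ᵥψ) w − (∂_w ψ) v`, `ψ ∈ C_c^∞(U)`, integrate by parts, fundamental lemma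
of the calculus of variations on `U`; Galdi, Lemma III.1.1; Temam, Ch. I Prop. 1.1). The
whole-space case is `FluidPDE.inner_fderiv_comm_of_forall_integral_inner_eq_zero`. [folklore] -/
theorem inner_fderiv_comm_of_forall_integral_inner_eq_zero_on {U : Set E} (hU : IsOpen U)
    {g : E → E} (hg : ContDiff ℝ ∞ g)
    (horth : ∀ φ : E → E, FunctionSpaces.IsTestFunctionOn ⟨U, hU⟩ φ →
      (∀ x, VectorCalculus.divergence φ x = 0) → ∫ x, ⟪g x, φ x⟫ = 0)
    {x : E} (hx : x ∈ U) (v w : E) :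
    ⟪fderiv ℝ g x v, w⟫ = ⟪fderiv ℝ g x w, v⟫ := by
  -- adapted from `FluidPDE.inner_fderiv_comm_of_forall_integral_inner_eq_zero` (whole space)
  have hk : ∀ z : E, ContDiff ℝ ∞ (fun y => ⟪g y, z⟫) := fun z => hg.inner ℝ contDiff_const
  have hk1 : ∀ z : E, ContDiff ℝ 1 (fun y => ⟪g y, z⟫) := fun z =>
    (hk z).of_le (by exact_mod_cast le_top)
  have hdk : ∀ z e y : E, fderiv ℝ (fun y => ⟪g y, z⟫) y e = ⟪fderiv ℝ g y e, z⟫ := by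
    intro z e y
    rw [fderiv_inner_apply ℝ ((hg.differentiable (by simp)) y) (differentiableAt_const z)]
    simp
  set m : E → ℝ := fun y => ⟪fderiv ℝ g y v, w⟫ - ⟪fderiv ℝ g y w, v⟫ with hm
  have hmc : Continuous m := by
    have hc : ∀ e z : E, Continuous fun y => ⟪fderiv ℝ g y e, z⟫ := fun e z =>
      ((hg.continuous_fderiv (by simp)).clm_apply continuous_const).inner continuous_const
    exact (hc v w).sub (hc w v)
  -- `∫ ψ m = 0` for every test function `ψ` supported in `U`
  have hzero : ∀ ψ : E → ℝ, ContDiff ℝ ∞ ψ → HasCompactSupport ψ → tsupport ψ ⊆ U →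
      ∫ y, ψ y • m y = 0 := by
    intro ψ hψ hsupp hψU
    have hψt : FunctionSpaces.IsTestFunctionOn ⟨U, hU⟩ ψ := ⟨hψ, hsupp, hψU⟩
    have h1 := horth _ (isTestFunctionOn_fderiv_smul_sub hψt v w)
      (isDivFree_fderiv_smul_sub hψ v w)
    have hexp : ∀ y, ⟪g y, (fderiv ℝ ψ y v) • w - (fderiv ℝ ψ y w) • v⟫ =
        fderiv ℝ ψ y v * ⟪g y, w⟫ - fderiv ℝ ψ y w * ⟪g y, v⟫ := fun y => by
      rw [inner_sub_right, real_inner_smul_right, real_inner_smul_right]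
    simp_rw [hexp] at h1
    have hi : ∀ e z : E, Integrable (fun y => fderiv ℝ ψ y e * ⟪g y, z⟫) := fun e z =>
      (((hψ.continuous_fderiv (by simp)).clm_apply continuous_const).mul (hk z).continuous)
        |>.integrable_of_hasCompactSupport ((hsupp.fderiv_apply (𝕜 := ℝ) e).mul_right)
    rw [integral_sub (hi v w) (hi w v), integral_fderiv_apply_mul_eq_neg hψ hsupp (hk1 w) v,
      integral_fderiv_apply_mul_eq_neg hψ hsupp (hk1 v) w] at h1
    have hi' : ∀ e z : E, Integrable (fun y => ψ y * fderiv ℝ (fun y => ⟪g y, z⟫) y e) :=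
      fun e z => (hψ.continuous.mul (((hk z).continuous_fderiv (by simp)).clm_apply
        continuous_const)).integrable_of_hasCompactSupport hsupp.mul_right
    have h2 : ∫ y, ψ y • m y = ∫ y, (ψ y * fderiv ℝ (fun y => ⟪g y, w⟫) y v -
        ψ y * fderiv ℝ (fun y => ⟪g y, v⟫) y w) := by
      refine integral_congr_ae (Eventually.of_forall fun y => ?_)
      simp only [hm, hdk, smul_eq_mul]
      ring
    rw [h2, integral_sub (hi' v w) (hi' w v)]
    linarith
  -- fundamental lemma on `U`: `m = 0` a.e. on `U`, hence on `U` by continuity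
  have hae : ∀ᵐ y ∂(volume : Measure E), y ∈ U → m y = 0 :=
    hU.ae_eq_zero_of_integral_contDiff_smul_eq_zero (hmc.locallyIntegrable.locallyIntegrableOn U)
      hzero
  have := eq_zero_of_ae_zero_on hU hmc hae hx
  simp only [hm] at this
  linarith

end Local

/-! ### The exterior of a ball in `ℝ³`: four shifted half-spaces -/

section Exterior

/-- The open half-space `{x | c < a₀x₀ + a₁x₁ + a₂x₂}` is open and convex. [folklore] -/
theorem isOpen_convex_halfSpace (a₀ a₁ a₂ c : ℝ) :
    IsOpen {x : EuclideanSpace ℝ (Fin 3) | c < a₀ * x 0 + a₁ * x 1 + a₂ * x 2} ∧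
      Convex ℝ {x : EuclideanSpace ℝ (Fin 3) | c < a₀ * x 0 + a₁ * x 1 + a₂ * x 2} := by
  have hlin : IsLinearMap ℝ fun x : EuclideanSpace ℝ (Fin 3) => a₀ * x 0 + a₁ * x 1 + a₂ * x 2 := by
    constructor
    · intro x y; simp only [PiLp.add_apply]; ring
    · intro c x; simp only [PiLp.smul_apply, smul_eq_mul]; ring
  refine ⟨?_, convex_halfSpace_gt hlin c⟩
  have hc : Continuous fun x : EuclideanSpace ℝ (Fin 3) => a₀ * x 0 + a₁ * x 1 + a₂ * x 2 := by fun_prop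
  exact isOpen_lt continuous_const hc

/-- `‖x‖² = x₀² + x₁² + x₂²` on `ℝ³`. [folklore] -/
private theorem norm_sq_eq_three (x : EuclideanSpace ℝ (Fin 3)) : ‖x‖ ^ 2 = x 0 ^ 2 + x 1 ^ 2 + x 2 ^ 2 := by
  rw [EuclideanSpace.norm_sq_eq, Fin.sum_univ_three]
  simp [sq_abs]

/-- A half-space `{2a < ±x₀ ± x₁ ± x₂}` lies in the exterior `{a < ‖x‖}` (Cauchy–Schwarz:
`(±x₀ ± x₁ ± x₂)² ≤ 3‖x‖²`). [folklore] -/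
theorem halfSpace_subset_exterior {a₀ a₁ a₂ : ℝ} (h₀ : a₀ ^ 2 = 1) (h₁ : a₁ ^ 2 = 1)
    (h₂ : a₂ ^ 2 = 1) (a : ℝ) :
    {x : EuclideanSpace ℝ (Fin 3) | 2 * a < a₀ * x 0 + a₁ * x 1 + a₂ * x 2} ⊆ {x : EuclideanSpace ℝ (Fin 3) | a < ‖x‖} := by
  intro x hx
  simp only [mem_setOf_eq] at hx ⊢
  have hn := norm_sq_eq_three x
  have hn0 := norm_nonneg x
  by_contra h
  push Not at h
  have hCS : (a₀ * x 0 + a₁ * x 1 + a₂ * x 2) ^ 2 ≤ 3 * ‖x‖ ^ 2 := by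
    rw [hn]
    nlinarith [sq_nonneg (a₀ * x 0 - a₁ * x 1), sq_nonneg (a₀ * x 0 - a₂ * x 2),
      sq_nonneg (a₁ * x 1 - a₂ * x 2), sq_nonneg (x 0), sq_nonneg (x 1), sq_nonneg (x 2)]
  nlinarith [sq_nonneg ‖x‖, sq_nonneg a]

/-- The four half-spaces `{2a < ⟪wᵢ, x⟫}`, `w = (1,1,1), (1,−1,−1), (−1,1,−1), (−1,−1,1)`, cover
`{4a < ‖x‖}` (if all four sums are `≤ 2a` then `|xₖ| ≤ 2a`, so `‖x‖² ≤ 12a²`). [folklore] -/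
theorem cover_halfSpaces_exterior {a : ℝ} {x : EuclideanSpace ℝ (Fin 3)} (hx : 4 * a < ‖x‖) :
    2 * a < x 0 + x 1 + x 2 ∨ 2 * a < x 0 - x 1 - x 2 ∨ 2 * a < -x 0 + x 1 - x 2 ∨
      2 * a < -x 0 - x 1 + x 2 := by
  by_contra h
  simp only [not_or, not_lt] at h
  obtain ⟨h1, h2, h3, h4⟩ := h
  have hn := norm_sq_eq_three x
  have hn0 := norm_nonneg x
  nlinarith [sq_nonneg (x 0), sq_nonneg (x 1), sq_nonneg (x 2)]

variable {F : Type*} [NormedAddCommGroup F] [NormedSpace ℝ F] [CompleteSpace F]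

/-- **Poincaré lemma on the exterior of a ball in `ℝ³`.** A `1`-form `η : ℝ³ → (ℝ³ →L[ℝ] F)`,
differentiable with symmetric derivative on `{a < ‖x‖}`, has a primitive on `{4a < ‖x‖}`
(cover by the four convex half-spaces `{2a < ⟪wᵢ, x⟫} ⊆ {a < ‖x‖}` and glue three times along
preconnected overlaps, as in `Sverak2011.exists_primitive_compl_zero`, the case `a = 0`).
[folklore] -/
theorem exists_primitive_exterior {η : EuclideanSpace ℝ (Fin 3) → EuclideanSpace ℝ (Fin 3) →L[ℝ] F} {a : ℝ}
    (hη : DifferentiableOn ℝ η {x | a < ‖x‖})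
    (hdη : ∀ p : EuclideanSpace ℝ (Fin 3), a < ‖p‖ → ∀ x y, fderiv ℝ η p x y = fderiv ℝ η p y x) :
    ∃ φ : EuclideanSpace ℝ (Fin 3) → F, ∀ x : EuclideanSpace ℝ (Fin 3), 4 * a < ‖x‖ → HasFDerivAt φ (η x) x := by
  -- adapted from `Sverak2011.exists_primitive_compl_zero` (the case `a = 0`)
  set H₁ : Set (EuclideanSpace ℝ (Fin 3)) := {x | 2 * a < 1 * x 0 + 1 * x 1 + 1 * x 2} with hH₁
  set H₂ : Set (EuclideanSpace ℝ (Fin 3)) := {x | 2 * a < 1 * x 0 + (-1) * x 1 + (-1) * x 2} with hH₂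
  set H₃ : Set (EuclideanSpace ℝ (Fin 3)) := {x | 2 * a < (-1) * x 0 + 1 * x 1 + (-1) * x 2} with hH₃
  set H₄ : Set (EuclideanSpace ℝ (Fin 3)) := {x | 2 * a < (-1) * x 0 + (-1) * x 1 + 1 * x 2} with hH₄
  obtain ⟨ho₁, hc₁⟩ := isOpen_convex_halfSpace (1 : ℝ) 1 1 (2 * a)
  obtain ⟨ho₂, hc₂⟩ := isOpen_convex_halfSpace (1 : ℝ) (-1) (-1) (2 * a)
  obtain ⟨ho₃, hc₃⟩ := isOpen_convex_halfSpace (-1 : ℝ) 1 (-1) (2 * a)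
  obtain ⟨ho₄, hc₄⟩ := isOpen_convex_halfSpace (-1 : ℝ) (-1) 1 (2 * a)
  have hprim : ∀ {a₀ a₁ a₂ : ℝ}, a₀ ^ 2 = 1 → a₁ ^ 2 = 1 → a₂ ^ 2 = 1 → ∃ f : EuclideanSpace ℝ (Fin 3) → F,
      ∀ x ∈ {x : EuclideanSpace ℝ (Fin 3) | 2 * a < a₀ * x 0 + a₁ * x 1 + a₂ * x 2}, HasFDerivAt f (η x) x := by
    intro a₀ a₁ a₂ h₀ h₁ h₂
    obtain ⟨ho, hc⟩ := isOpen_convex_halfSpace a₀ a₁ a₂ (2 * a)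
    have hsub := halfSpace_subset_exterior h₀ h₁ h₂ a
    exact hc.exists_forall_hasFDerivAt_of_fderiv_symmetric ho (hη.mono hsub)
      fun p hp x y => hdη p (hsub hp) x y
  obtain ⟨f₁, hf₁⟩ := hprim (a₀ := 1) (a₁ := 1) (a₂ := 1) (by norm_num) (by norm_num) (by norm_num)
  obtain ⟨f₂, hf₂⟩ := hprim (a₀ := 1) (a₁ := -1) (a₂ := -1) (by norm_num) (by norm_num)
    (by norm_num)
  obtain ⟨f₃, hf₃⟩ := hprim (a₀ := -1) (a₁ := 1) (a₂ := -1) (by norm_num) (by norm_num)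
    (by norm_num)
  obtain ⟨f₄, hf₄⟩ := hprim (a₀ := -1) (a₁ := -1) (a₂ := 1) (by norm_num) (by norm_num)
    (by norm_num)
  -- witnesses of the overlaps, far out along `(1,1,-1)`, `(1,-1,1)`, `(-1,1,1)`
  set t : ℝ := 2 * |a| + 1 with ht
  have hta : 2 * a < t := by
    rw [ht]
    cases abs_cases a <;> linarith
  have m₁₃ : (!₂[t, t, -t] : EuclideanSpace ℝ (Fin 3)) ∈ H₁ ∩ H₃ := by
    simp only [hH₁, hH₃, mem_inter_iff, mem_setOf_eq, Matrix.cons_val_zero,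
      Matrix.cons_val_one, Matrix.cons_val_two, Matrix.head_cons, Matrix.tail_cons]
    constructor <;> linarith
  have m₂₃ : (!₂[t, t, -t] : EuclideanSpace ℝ (Fin 3)) ∈ H₂ ∩ H₃ := by
    simp only [hH₂, hH₃, mem_inter_iff, mem_setOf_eq, Matrix.cons_val_zero,
      Matrix.cons_val_one, Matrix.cons_val_two, Matrix.head_cons, Matrix.tail_cons]
    constructor <;> linarith
  have m₁₄ : (!₂[t, -t, t] : EuclideanSpace ℝ (Fin 3)) ∈ H₁ ∩ H₄ := by
    simp only [hH₁, hH₄, mem_inter_iff, mem_setOf_eq, Matrix.cons_val_zero,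
      Matrix.cons_val_one, Matrix.cons_val_two, Matrix.head_cons, Matrix.tail_cons]
    constructor <;> linarith
  have m₂₄ : (!₂[t, -t, t] : EuclideanSpace ℝ (Fin 3)) ∈ H₂ ∩ H₄ := by
    simp only [hH₂, hH₄, mem_inter_iff, mem_setOf_eq, Matrix.cons_val_zero,
      Matrix.cons_val_one, Matrix.cons_val_two, Matrix.head_cons, Matrix.tail_cons]
    constructor <;> linarith
  have m₁₄' : (!₂[-t, t, t] : EuclideanSpace ℝ (Fin 3)) ∈ H₁ ∩ H₄ ∪ H₂ ∩ H₄ := by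
    refine Or.inl ?_
    simp only [hH₁, hH₄, mem_inter_iff, mem_setOf_eq, Matrix.cons_val_zero,
      Matrix.cons_val_one, Matrix.cons_val_two, Matrix.head_cons, Matrix.tail_cons]
    constructor <;> linarith
  have m₃₄ : (!₂[-t, t, t] : EuclideanSpace ℝ (Fin 3)) ∈ H₃ ∩ H₄ := by
    simp only [hH₃, hH₄, mem_inter_iff, mem_setOf_eq, Matrix.cons_val_zero,
      Matrix.cons_val_one, Matrix.cons_val_two, Matrix.head_cons, Matrix.tail_cons]
    constructor <;> linarith
  -- glue
  obtain ⟨g₂, hg₂⟩ := Sverak2011.exists_primitive_union ho₁ ho₂ (hc₁.inter hc₂).isPreconnected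
    hf₁ hf₂
  have hpre₃ : IsPreconnected ((H₁ ∪ H₂) ∩ H₃) := by
    rw [union_inter_distrib_right]
    exact IsPreconnected.union _ m₁₃ m₂₃ (hc₁.inter hc₃).isPreconnected
      (hc₂.inter hc₃).isPreconnected
  obtain ⟨g₃, hg₃⟩ := Sverak2011.exists_primitive_union (ho₁.union ho₂) ho₃ hpre₃ hg₂ hf₃
  have hpre₄ : IsPreconnected ((H₁ ∪ H₂ ∪ H₃) ∩ H₄) := by
    rw [union_inter_distrib_right, union_inter_distrib_right]
    exact IsPreconnected.union _ m₁₄' m₃₄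
      (IsPreconnected.union _ m₁₄ m₂₄ (hc₁.inter hc₄).isPreconnected
        (hc₂.inter hc₄).isPreconnected) (hc₃.inter hc₄).isPreconnected
  obtain ⟨g₄, hg₄⟩ := Sverak2011.exists_primitive_union ((ho₁.union ho₂).union ho₃) ho₄ hpre₄
    hg₃ hf₄
  refine ⟨g₄, fun x hx => hg₄ x ?_⟩
  rcases cover_halfSpaces_exterior hx with h | h | h | h
  · exact Or.inl (Or.inl (Or.inl (by simp; linarith)))
  · exact Or.inl (Or.inl (Or.inr (by simp; linarith)))
  · exact Or.inl (Or.inr (by simp; linarith))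
  · exact Or.inr (by simp; linarith)

/-- **de Rham on the exterior of a ball (smooth fields).** Let `g : ℝ³ → ℝ³` be smooth and
`L²`-orthogonal to every smooth divergence-free field compactly supported in `{a < ‖x‖}`. Then
`g` is a gradient on `{4a < ‖x‖}`: there is `q`, smooth on `{4a < ‖x‖}`, with `∇q = g` there
(local de Rham `inner_fderiv_comm_of_forall_integral_inner_eq_zero_on` gives `curl g = 0` on
`{a < ‖x‖}`, and the Poincaré lemma `exists_primitive_exterior` integrates it; the exterior of a
ball in `ℝ³` is simply connected — the loss `a ↦ 4a` comes from the four-half-space cover and is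
harmless for shells accumulating at a sphere). This is the pressure of a smooth LINEAR Euler
subsolution off a ball: if `∫ S : ∇φ = 0` for solenoidal tests off `B̄_a` then
`div S = -∇P` on `{4a < ‖x‖}` (Galdi, Lemma III.1.1; Temam, Ch. I, Prop. 1.1). [folklore] -/
theorem exists_potential_of_forall_integral_inner_eq_zero {g : EuclideanSpace ℝ (Fin 3) → EuclideanSpace ℝ (Fin 3)} (hg : ContDiff ℝ ∞ g)
    {a : ℝ}
    (horth : ∀ φ : EuclideanSpace ℝ (Fin 3) → EuclideanSpace ℝ (Fin 3), FunctionSpaces.IsTestFunctionOn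
      ⟨{x : EuclideanSpace ℝ (Fin 3) | a < ‖x‖}, isOpen_lt continuous_const continuous_norm⟩ φ →
      (∀ x, VectorCalculus.divergence φ x = 0) → ∫ x, ⟪g x, φ x⟫ = 0) :
    ∃ q : EuclideanSpace ℝ (Fin 3) → ℝ, ContDiffOn ℝ ∞ q {x : EuclideanSpace ℝ (Fin 3) | 4 * a < ‖x‖} ∧
      ∀ x : EuclideanSpace ℝ (Fin 3), 4 * a < ‖x‖ → HasGradientAt q (g x) x := by
  have hU : IsOpen {x : EuclideanSpace ℝ (Fin 3) | a < ‖x‖} := isOpen_lt continuous_const continuous_norm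
  have hU' : IsOpen {x : EuclideanSpace ℝ (Fin 3) | 4 * a < ‖x‖} := isOpen_lt continuous_const continuous_norm
  have hsymm : ∀ x : EuclideanSpace ℝ (Fin 3), a < ‖x‖ → ∀ v w : EuclideanSpace ℝ (Fin 3), ⟪fderiv ℝ g x v, w⟫ = ⟪fderiv ℝ g x w, v⟫ :=
    fun x hx v w => inner_fderiv_comm_of_forall_integral_inner_eq_zero_on hU hg horth hx v w
  -- the `1`-form `η = ⟪g, ·⟫`
  set η : EuclideanSpace ℝ (Fin 3) → EuclideanSpace ℝ (Fin 3) →L[ℝ] ℝ := fun x => innerSL ℝ (g x) with hη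
  have hηD : ∀ x : EuclideanSpace ℝ (Fin 3),
      HasFDerivAt η ((innerSL ℝ : EuclideanSpace ℝ (Fin 3) →L[ℝ] EuclideanSpace ℝ (Fin 3) →L[ℝ] ℝ).comp (fderiv ℝ g x)) x := fun x =>
    (innerSL ℝ : EuclideanSpace ℝ (Fin 3) →L[ℝ] EuclideanSpace ℝ (Fin 3) →L[ℝ] ℝ).hasFDerivAt.comp x
      ((hg.differentiable (by simp)) x).hasFDerivAt
  have hηd : DifferentiableOn ℝ η {x : EuclideanSpace ℝ (Fin 3) | a < ‖x‖} := fun x _ =>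
    (hηD x).differentiableAt.differentiableWithinAt
  obtain ⟨q, hq⟩ := exists_primitive_exterior (F := ℝ) hηd (fun p hp x y => by
    rw [(hηD p).fderiv]
    simp only [ContinuousLinearMap.coe_comp, Function.comp_apply, innerSL_apply_apply]
    exact hsymm p hp x y)
  refine ⟨q, ?_, fun x hx => ?_⟩
  · -- smoothness: `Dq = innerSL ∘ g` is smooth on the open set
    have hfd : ∀ x ∈ {x : EuclideanSpace ℝ (Fin 3) | 4 * a < ‖x‖}, fderiv ℝ q x = η x := fun x hx => (hq x hx).fderiv
    have h1 : ContDiffOn ℝ ∞ (fderiv ℝ q) {x : EuclideanSpace ℝ (Fin 3) | 4 * a < ‖x‖} :=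
      (((innerSL ℝ : EuclideanSpace ℝ (Fin 3) →L[ℝ] EuclideanSpace ℝ (Fin 3) →L[ℝ] ℝ).contDiff.comp hg).contDiffOn).congr hfd
    rw [show ((⊤ : ℕ∞) : WithTop ℕ∞) = (⊤ : ℕ∞) + 1 from rfl,
      contDiffOn_succ_iff_fderiv_of_isOpen hU']
    exact ⟨fun x hx => (hq x hx).differentiableAt.differentiableWithinAt, by simp, h1⟩
  · have he : (InnerProductSpace.toDual ℝ (EuclideanSpace ℝ (Fin 3))) (g x) = η x := by
      ext y
      simp [hη, InnerProductSpace.toDual_apply_apply]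
    rw [hasGradientAt_iff_hasFDerivAt, he]
    exact hq x hx

end Exterior

end ExteriorDeRham

end Literature.Analysis.FluidPDE

end
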